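import Summits.Ventures.QEC.Census.CertInfoSetSound
import Summits.Ventures.QEC.Census.BZAutPerm
import HarnessLib

/-!
# Orbit-averaged information-set lower bounds for CSS distance certificates — checks and combinatorics
# (qec-search-4 g4; a new lower-bound LANE next to `bruteforce` / `mitm` / `bz` / `bz_aut`; CERT-FORMAT §5 method family)

THE ARGUMENT (elementary double counting; the use of code automorphisms to shrink a minimum-weight enumeration is
[Grassl 2006 §2.2]; the information-set decomposition is qec-search-7's `Census/CertInfoSet.lean`).  Fix one side of a
CSS certificate: syndrome rows `Hsyn`, stabilizer rows `Hstab`, threshold `wmax`.  Let `Φ` be a list of `q` qubit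
permutations that are automorphisms of both check matrices (type-12 `AutGen` generators and words), and let a VIEW be a
reduced-row-echelon certificate of `Hsyn` (search-7 `InfoSetCert`: pivots `piv`, the FREE columns form an information
set of `ker Hsyn`) with an enumeration depth `t`.  For a support `c ⊆ {0,…,n−1}` put
`mult(x) := #{φ ∈ Φ : φ(x) is free}`; then

  `Σ_{φ ∈ Φ} #(φ(c) ∩ free) = Σ_{x ∈ c} mult(x)`,

so SOME `φ(c)` has at most `⌊Σ_{x∈c} mult(x) / q⌋` free points.  A non-trivial logical `w` of weight `≤ wmax` is thus
transported (same weight, still non-trivial: type-12 `zLogical_comp_equiv_symm_of_rowMap`) to one whose free support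
has `≤ t` points whenever `Σ_{x ∈ supp w} mult(x) < q (t + 1)`, and such a vector is the XOR of `≤ t` kernel-basis words
(`eq_ofBits_freeSupp`) — which the replay of the view (type-01's lane engine at depth `t`, leaf `bzLeaf wmax allow`)
has classified as heavy or allow-listed.  With several views `(piv_s, t_s)` the per-support condition is
`∃ s, Σ_{x ∈ c} mult_s(x) < q (t_s + 1)`; the kernel checks it for EVERY support of size `1 … wmax` through the
coordinate CLASSES of a shipped class map `cls` (on which every `mult_s` is constant — checked pointwise) by
enumerating the class profiles `(p_0,…,p_{m−1})`, `Σ p_j ≤ wmax`, `p_j ≤ #class j`.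

For abelian two-block codes (`GB`, `BB`, `2BGA`; two free orbits of the translation group) two views with
free-column profiles `(ℓ, K−ℓ)` / `(K−ℓ, ℓ)` bring a `d = 8` side of `[[126,28,8]]` (PK21q, `k = 28`) down to
`2 × 76 153` codeword selections at depth `3` — where label covers and meet-in-the-middle tables grow with `2^k` / `n^4`.

This file: the Bool CHECKS (`orbMult`, `multTabOK`, `profGo`, `orbitProfileOK`), small list combinatorics
(`countB`, swap / averaging lemmas, `profGo` soundness).  Soundness of the lane (and the `rowPos` bridge to the lane
engine's `Reaches` statement): `Census/CertInfoSetOrbitSound.lean`.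
No certificate is read here and no distance value is asserted; axioms ⊆ {propext, Classical.choice, Quot.sound}.
-/

set_option autoImplicit false

namespace Summit.Ventures.QEC.Census

open Matrix Literature.InformationTheory.QuantumCodes

/-! ## Counting with a Bool predicate (own recursion: kernel-cheap and lemma-light) -/

/-- `countB p l` = the number of entries of `l` satisfying `p`. (definition, structural) -/
def countB (p : ℕ → Bool) : List ℕ → ℕ
  | [] => 0
  | x :: xs => (cond (p x) 1 0) + countB p xs

section CountB

variable (p : ℕ → Bool)

/-- `countB` of the empty list. -/
@[simp] theorem countB_nil : countB p [] = 0 := rfl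

/-- `countB` of a cons. -/
theorem countB_cons (x : ℕ) (xs : List ℕ) : countB p (x :: xs) = (cond (p x) 1 0) + countB p xs := rfl

/-- `countB` is at most the length. -/
theorem countB_le_length : ∀ l : List ℕ, countB p l ≤ l.length
  | [] => le_rfl
  | x :: xs => by
    rw [countB_cons, List.length_cons]
    have := countB_le_length xs
    cases p x <;> simp <;> omega

/-- `countB` is monotone along sublists. -/
theorem countB_le_of_sublist {l₁ l₂ : List ℕ} (h : l₁.Sublist l₂) : countB p l₁ ≤ countB p l₂ := by
  induction h with
  | slnil => exact le_rfl
  | cons x _ ih => rw [countB_cons]; omega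
  | cons_cons x _ ih => rw [countB_cons, countB_cons]; omega

/-- `countB` of an append. -/
theorem countB_append (l₁ l₂ : List ℕ) : countB p (l₁ ++ l₂) = countB p l₁ + countB p l₂ := by
  induction l₁ with
  | nil => simp
  | cons x xs ih => rw [List.cons_append, countB_cons, countB_cons, ih]; omega

/-- `countB` over a `Nodup` list of naturals below `n` equals the cardinality of the corresponding `Finset (Fin n)`
filter, for the list `suppIdx n v` of a vector's support: `countB p (suppIdx n v) = #{i | v i ≠ 0 ∧ p i}`. -/
theorem countB_suppIdx {n : ℕ} (v : Fin n → ZMod 2) :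
    countB p (suppIdx n v) = (Finset.univ.filter fun i : Fin n => v i ≠ 0 ∧ p i = true).card := by
  -- both sides are the length of the filtered `finRange`
  have key : ∀ (L : List (Fin n)), L.Nodup →
      countB p (L.filter (fun j => decide (v j ≠ 0)) |>.map Fin.val) =
        (L.toFinset.filter fun i : Fin n => v i ≠ 0 ∧ p i = true).card := by
    intro L hL
    induction L with
    | nil => simp
    | cons a L ih =>
      rw [List.nodup_cons] at hL
      have haL : a ∉ L.toFinset := by simpa using hL.1
      rw [List.toFinset_cons, Finset.filter_insert, List.filter_cons]
      by_cases ha : v a ≠ 0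
      · have hd : decide (v a ≠ 0) = true := decide_eq_true ha
        rw [if_pos hd, List.map_cons, countB_cons, ih hL.2]
        by_cases hp : p a = true
        · rw [if_pos ⟨ha, hp⟩, Finset.card_insert_of_notMem (fun h => haL (Finset.mem_of_mem_filter _ h)), hp,
            cond_true]
          omega
        · rw [if_neg (fun h => hp h.2), Bool.eq_false_iff.mpr hp, cond_false, Nat.zero_add]
      · have hd : ¬ (decide (v a ≠ 0) = true) := by simpa using ha
        rw [if_neg hd, if_neg (fun h => ha h.1), ih hL.2]
  have := key (List.finRange n) (List.nodup_finRange n)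
  rw [List.toFinset_finRange] at this
  exact this

end CountB

/-! ## The checks -/

/-- `x` is a FREE column of the view with pivots `piv` (i.e. in the information set). (definition) -/
def isFree (piv : List ℕ) (x : ℕ) : Bool := !(piv.elem x)

/-- The orbit multiplicity of coordinate `x` for a list of permutation tables: the number of tables moving `x` to a free
column. (definition) -/
def orbMult (tabs : List (List ℕ)) (piv : List ℕ) (x : ℕ) : ℕ :=
  countB (fun i => isFree piv (permFun (tabs.getD i []) x)) (List.range tabs.length)

/-- One VIEW of the orbit lane: a reduced-row-echelon certificate of the syndrome matrix (search-7 `InfoSetCert`; the free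
columns are the information set) and the enumeration depth `t` of its kernel basis. (structure) -/
structure OrbitView where
  /-- RREF certificate: pivots, reduced rows, row decompositions -/
  ic : InfoSetCert
  /-- enumeration depth -/
  t : ℕ

/-- **Class table check**: `cls` has length `n`, every class is `< μ.length`, and for every coordinate `x < n` and view
`s`, `orbMult tabs piv_s x = μ[cls x][s]` (class-major table `μ`). (definition) -/
def multTabOK (n : ℕ) (tabs : List (List ℕ)) (views : List OrbitView) (cls : List ℕ) (μ : List (List ℕ)) : Bool :=
  (cls.length == n) &&
    (List.range n).all fun x => decide (cls.getD x 0 < μ.length) &&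
      (List.range views.length).all fun s =>
        orbMult tabs (views.getD s ⟨⟨[], [], []⟩, 0⟩).ic.piv x == (μ.getD (cls.getD x 0) []).getD s 0

/-- Pointwise `acc_s + p · col_s` (missing entries of `col` read as `0`, result has the length of `acc`). (definition) -/
def addMul (p : ℕ) : List ℕ → List ℕ → List ℕ
  | [], _ => []
  | a :: as, [] => a :: addMul p as []
  | a :: as, c :: cs => (a + p * c) :: addMul p as cs

/-- Some entry of `acc` is strictly below the corresponding entry of `bnd`. (definition) -/
def anyLt : List ℕ → List ℕ → Bool
  | a :: as, b :: bs => decide (a < b) || anyLt as bs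
  | _, _ => false

/-- **Profile recursion**: classes remaining (their `μ` columns and sizes), budget `r` still to distribute, `used` points
placed so far, accumulated sums `acc` (one per view), bounds `bnd`.  At the end: the empty profile, or some view below its
bound.  (definition, structural on the class list) -/
def profGo : List (List ℕ) → List ℕ → ℕ → ℕ → List ℕ → List ℕ → Bool
  | [], _, _, used, acc, bnd => (used == 0) || anyLt acc bnd
  | μj :: μs, cnts, r, used, acc, bnd =>
    (List.range (min r (cnts.headD 0) + 1)).all fun p =>
      profGo μs cnts.tail (r - p) (used + p) (addMul p acc μj) bnd

/-- Class sizes: `#{x < n : cls x = j}` for `j < m`. (definition) -/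
def classSizes (n m : ℕ) (cls : List ℕ) : List ℕ :=
  (List.range m).map fun j => countB (fun x => cls.getD x 0 == j) (List.range n)

/-- The bounds `q · (t_s + 1)`. (definition) -/
def orbBounds (q : ℕ) (views : List OrbitView) : List ℕ := views.map fun v => q * (v.t + 1)

/-- **The orbit-profile check** of one side: class table + every class profile of total size `1 … wmax` has a view `s`
with `Σ_j p_j μ[j][s] < q (t_s + 1)`, `q = |tabs|`. (definition) -/
def orbitProfileOK (n wmax : ℕ) (tabs : List (List ℕ)) (views : List OrbitView) (cls : List ℕ) (μ : List (List ℕ)) :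
    Bool :=
  multTabOK n tabs views cls μ &&
    profGo μ (classSizes n μ.length cls) wmax 0 (List.replicate views.length 0) (orbBounds tabs.length views)

/-! ## Semantics of `addMul` / `anyLt` / `profGo` -/

section Prof

/-- `addMul` keeps the length of the accumulator. -/
theorem length_addMul (p : ℕ) : ∀ (acc col : List ℕ), (addMul p acc col).length = acc.length
  | [], _ => rfl
  | a :: as, [] => by rw [addMul, List.length_cons, List.length_cons, length_addMul p as []]
  | a :: as, c :: cs => by rw [addMul, List.length_cons, List.length_cons, length_addMul p as cs]

/-- Entries of `addMul`. -/
theorem getD_addMul (p : ℕ) : ∀ (acc col : List ℕ) (s : ℕ), s < acc.length →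
    (addMul p acc col).getD s 0 = acc.getD s 0 + p * col.getD s 0
  | [], _, s, hs => absurd hs (Nat.not_lt_zero _)
  | a :: as, [], 0, _ => by simp [addMul]
  | a :: as, [], s + 1, hs => by
    simp only [addMul, List.getD_cons_succ, List.getD_nil, mul_zero, add_zero]
    have := getD_addMul p as [] s (by simpa using hs)
    simpa using this
  | a :: as, c :: cs, 0, _ => by simp [addMul]
  | a :: as, c :: cs, s + 1, hs => by
    simp only [addMul, List.getD_cons_succ]
    exact getD_addMul p as cs s (by simpa using hs)

/-- `anyLt acc bnd` gives an index below both lengths where `acc < bnd`. -/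
theorem exists_of_anyLt : ∀ (acc bnd : List ℕ), anyLt acc bnd = true →
    ∃ s, s < acc.length ∧ s < bnd.length ∧ acc.getD s 0 < bnd.getD s 0
  | [], _, h => by simp [anyLt] at h
  | _ :: _, [], h => by simp [anyLt] at h
  | a :: as, b :: bs, h => by
    simp only [anyLt, Bool.or_eq_true, decide_eq_true_eq] at h
    rcases h with h | h
    · exact ⟨0, by simp, by simp, by simpa using h⟩
    · obtain ⟨s, hs1, hs2, hlt⟩ := exists_of_anyLt as bs h
      exact ⟨s + 1, by simpa using hs1, by simpa using hs2, by simpa using hlt⟩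

/-- The accumulated sum of a profile `ps` against class columns `M` at view `s`: `Σ_j ps[j] · M[j][s]`. (definition) -/
def profSum (ps : List ℕ) (M : List (List ℕ)) (s : ℕ) : ℕ :=
  ((List.range M.length).map fun j => ps.getD j 0 * (M.getD j []).getD s 0).sum

/-- `profSum` of a cons. -/
theorem profSum_cons (p : ℕ) (ps : List ℕ) (μj : List ℕ) (M : List (List ℕ)) (s : ℕ) :
    profSum (p :: ps) (μj :: M) s = p * μj.getD s 0 + profSum ps M s := by
  simp only [profSum, List.length_cons, List.range_succ_eq_map, List.map_cons, List.map_map, List.sum_cons,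
    List.getD_cons_zero]
  congr 1

/-- **Soundness of `profGo`.**  If the recursion passes from state `(M, cnts, r, used, acc, bnd)`, then for every profile
`ps` over the remaining classes (`|ps| = |M|`, `ps[j] ≤ cnts[j]`, `Σ ps ≤ r`): either `used + Σ ps = 0`, or some view
`s < |acc|`, `s < |bnd|` has `acc[s] + Σ_j ps[j] M[j][s] < bnd[s]`. -/
theorem profGo_sound : ∀ (M : List (List ℕ)) (cnts : List ℕ) (r used : ℕ) (acc bnd : List ℕ),
    profGo M cnts r used acc bnd = true →
    ∀ ps : List ℕ, ps.length = M.length → (∀ j, j < M.length → ps.getD j 0 ≤ cnts.getD j 0) → ps.sum ≤ r →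
      used + ps.sum = 0 ∨ ∃ s, s < acc.length ∧ s < bnd.length ∧ acc.getD s 0 + profSum ps M s < bnd.getD s 0
  | [], cnts, r, used, acc, bnd, h, ps, hlen, _, _ => by
    have hps : ps = [] := List.eq_nil_of_length_eq_zero hlen
    subst hps
    simp only [profGo, Bool.or_eq_true, beq_iff_eq] at h
    rcases h with h | h
    · left; simpa using h
    · right
      obtain ⟨s, h1, h2, h3⟩ := exists_of_anyLt acc bnd h
      exact ⟨s, h1, h2, by simpa [profSum] using h3⟩
  | μj :: M, cnts, r, used, acc, bnd, h, ps, hlen, hcap, hsum => by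
    obtain ⟨p, ps', rfl⟩ : ∃ p ps', ps = p :: ps' := by
      cases ps with
      | nil => simp at hlen
      | cons p ps' => exact ⟨p, ps', rfl⟩
    simp only [List.length_cons, Nat.add_right_cancel_iff] at hlen
    rw [List.sum_cons] at hsum
    have hp0 := hcap 0 (by simp)
    simp only [List.getD_cons_zero] at hp0
    have hpc : p ≤ cnts.headD 0 := by cases cnts <;> simpa using hp0
    have hpr : p ≤ r := by omega
    simp only [profGo, List.all_eq_true, List.mem_range] at h
    have hstep := h p (by omega)
    have hcap' : ∀ j, j < M.length → ps'.getD j 0 ≤ cnts.tail.getD j 0 := fun j hj => by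
      have := hcap (j + 1) (by simpa using hj)
      cases cnts <;> simpa using this
    rcases profGo_sound M cnts.tail (r - p) (used + p) (addMul p acc μj) bnd hstep ps' hlen hcap' (by omega) with
      h0 | ⟨s, hs1, hs2, hlt⟩
    · left; rw [List.sum_cons]; omega
    · right
      rw [length_addMul] at hs1
      refine ⟨s, hs1, hs2, ?_⟩
      rw [getD_addMul p acc μj s hs1] at hlt
      rw [profSum_cons]
      omega

end Prof

/-! ## Grouping a sum by classes -/

section Classes

/-- The class profile of a list of coordinates: `p_j = #{x ∈ L : cls x = j}`, `j < m`. (definition) -/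
def profileOf (cls : List ℕ) (m : ℕ) (L : List ℕ) : List ℕ :=
  (List.range m).map fun j => countB (fun x => cls.getD x 0 == j) L

/-- A profile has one entry per class. -/
theorem length_profileOf (cls : List ℕ) (m : ℕ) (L : List ℕ) : (profileOf cls m L).length = m := by
  simp [profileOf]

/-- Entry `j` of a profile. -/
theorem getD_profileOf (cls : List ℕ) (m : ℕ) (L : List ℕ) {j : ℕ} (hj : j < m) :
    (profileOf cls m L).getD j 0 = countB (fun x => cls.getD x 0 == j) L := by
  rw [profileOf, List.getD_eq_getElem?_getD, List.getElem?_map, List.getElem?_range hj, Option.map_some,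
    Option.getD_some]

/-- The profile entries sum to the length when every class is `< m`. -/
theorem sum_profileOf (cls : List ℕ) (m : ℕ) : ∀ (L : List ℕ), (∀ x ∈ L, cls.getD x 0 < m) →
    (profileOf cls m L).sum = L.length
  | [], _ => by simp [profileOf]
  | x :: L, h => by
    have hx : cls.getD x 0 < m := h x (by simp)
    have hL : ∀ y ∈ L, cls.getD y 0 < m := fun y hy => h y (by simp [hy])
    have ih := sum_profileOf cls m L hL
    simp only [profileOf, countB_cons] at ih ⊢
    rw [show ((List.range m).map fun j => (cond (cls.getD x 0 == j) 1 0) + countB (fun y => cls.getD y 0 == j) L) =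
      ((List.range m).map fun j => (cond (cls.getD x 0 == j) 1 0) + (fun j => countB (fun y => cls.getD y 0 == j) L) j)
      from rfl, List.sum_map_add]
    simp only [ih, List.length_cons]
    suffices (((List.range m).map fun j => cond (cls.getD x 0 == j) 1 0).sum) = 1 by omega
    -- exactly one class matches
    have : ∀ (m' : ℕ), cls.getD x 0 < m' → (((List.range m').map fun j => cond (cls.getD x 0 == j) 1 0).sum) = 1 := by
      intro m' hm'
      induction m' with
      | zero => omega
      | succ m' ihm =>
        rw [List.range_succ, List.map_append, List.sum_append, List.map_singleton, List.sum_singleton]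
        by_cases heq : cls.getD x 0 = m'
        · subst heq
          have h0 : (((List.range (cls.getD x 0)).map fun j => cond (cls.getD x 0 == j) 1 0).sum) = 0 := by
            refine List.sum_eq_zero fun y hy => ?_
            rw [List.mem_map] at hy
            obtain ⟨j, hj, rfl⟩ := hy
            rw [List.mem_range] at hj
            have : (cls.getD x 0 == j) = false := by rw [beq_eq_false_iff_ne]; omega
            rw [this]; rfl
          rw [h0]; simp
        · rw [ihm (by omega)]
          have : (cls.getD x 0 == m') = false := by rw [beq_eq_false_iff_ne]; exact heq
          rw [this]; rfl
    exact this m hx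

/-- **Grouping by classes**: if `f x = g (cls x)` on `L` and every class is `< m`, then
`Σ_{x ∈ L} f x = Σ_{j < m} p_j · g j`. -/
theorem sum_map_eq_profSum_aux (cls : List ℕ) (m : ℕ) (f g : ℕ → ℕ) : ∀ (L : List ℕ),
    (∀ x ∈ L, cls.getD x 0 < m) → (∀ x ∈ L, f x = g (cls.getD x 0)) →
    (L.map f).sum = ((List.range m).map fun j => countB (fun x => cls.getD x 0 == j) L * g j).sum
  | [], _, _ => by simp
  | x :: L, hm, hfg => by
    have hx : cls.getD x 0 < m := hm x (by simp)
    have ih := sum_map_eq_profSum_aux cls m f g L (fun y hy => hm y (by simp [hy])) (fun y hy => hfg y (by simp [hy]))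
    rw [List.map_cons, List.sum_cons, ih, hfg x (by simp)]
    simp only [countB_cons, Nat.add_mul]
    rw [show ((List.range m).map fun j => cond (cls.getD x 0 == j) 1 0 * g j + countB (fun y => cls.getD y 0 == j) L * g j)
      = ((List.range m).map fun j => (fun j => cond (cls.getD x 0 == j) 1 0 * g j) j +
          (fun j => countB (fun y => cls.getD y 0 == j) L * g j) j) from rfl, List.sum_map_add]
    suffices (((List.range m).map fun j => cond (cls.getD x 0 == j) 1 0 * g j).sum) = g (cls.getD x 0) by omega
    have : ∀ (m' : ℕ), cls.getD x 0 < m' → (((List.range m').map fun j => cond (cls.getD x 0 == j) 1 0 * g j).sum)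
        = g (cls.getD x 0) := by
      intro m' hm'
      induction m' with
      | zero => omega
      | succ m' ihm =>
        rw [List.range_succ, List.map_append, List.sum_append, List.map_singleton, List.sum_singleton]
        by_cases heq : cls.getD x 0 = m'
        · subst heq
          have h0 : (((List.range (cls.getD x 0)).map fun j => cond (cls.getD x 0 == j) 1 0 * g j).sum) = 0 := by
            refine List.sum_eq_zero fun y hy => ?_
            rw [List.mem_map] at hy
            obtain ⟨j, hj, rfl⟩ := hy
            rw [List.mem_range] at hj
            have : (cls.getD x 0 == j) = false := by rw [beq_eq_false_iff_ne]; omega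
            rw [this]; simp
          rw [h0]; simp
        · rw [ihm (by omega)]
          have : (cls.getD x 0 == m') = false := by rw [beq_eq_false_iff_ne]; exact heq
          rw [this]; simp
    exact this m hx

end Classes

/-! ## Double counting and averaging -/

section Average

/-- **Swap of a double count**: `Σ_{i ∈ A} #{x ∈ B : P i x} = Σ_{x ∈ B} #{i ∈ A : P i x}`. -/
theorem sum_countB_swap (P : ℕ → ℕ → Bool) (A : List ℕ) : ∀ (B : List ℕ),
    (A.map fun i => countB (P i) B).sum = (B.map fun x => countB (fun i => P i x) A).sum
  | [] => by simp
  | x :: B => by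
    rw [List.map_cons, List.sum_cons, ← sum_countB_swap P A B]
    simp only [countB_cons]
    rw [show (A.map fun i => cond (P i x) 1 0 + countB (P i) B) =
      (A.map fun i => (fun i => cond (P i x) 1 0) i + (fun i => countB (P i) B) i) from rfl, List.sum_map_add]
    congr 1
    induction A with
    | nil => simp
    | cons a A ih => rw [List.map_cons, List.sum_cons, countB_cons, ih]

/-- **Averaging**: if `Σ_{i ∈ A} f i < |A| · (t + 1)` then some `i ∈ A` has `f i ≤ t`. -/
theorem exists_le_of_sum_lt (f : ℕ → ℕ) (t : ℕ) : ∀ (A : List ℕ), (A.map f).sum < A.length * (t + 1) →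
    ∃ i ∈ A, f i ≤ t
  | [], h => by simp at h
  | a :: A, h => by
    by_cases ha : f a ≤ t
    · exact ⟨a, by simp, ha⟩
    · have h' : (A.map f).sum < A.length * (t + 1) := by
        rw [List.map_cons, List.sum_cons, List.length_cons] at h
        rw [not_le] at ha
        rw [Nat.succ_mul] at h
        omega
      obtain ⟨i, hi, hle⟩ := exists_le_of_sum_lt f t A h'
      exact ⟨i, by simp [hi], hle⟩

end Average

end Summit.Ventures.QEC.Census
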